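import Summits.AtomisticToContinuum.HydrodynamicLimit.Theorems.CollisionIsometryCLTAdaptedWeightCLTTLPastDampingDecomposition
import Summits.AtomisticToContinuum.HydrodynamicLimit.Theorems.CollisionIsometryCLTAdaptedWeightCLTTLPastDampingKernel

/-!
# Stub `stub_pastDamping` of the line `contact-source-duhamel` — helper file: the PATHWISE PAST
INEQUALITY at a point (crux `CollisionIsometryCLT.AdaptedWeightCLT`, stmt-AtomisticToContinuum-14868,
`--supports`)

Squares and sums of the decomposition `PAST = M + R` of `…TLPastDampingDecomposition.lean`, for
non-negative weights `w` with total `W = Σ_i w_i`, shift `u`, `a_k = v_k − u`: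

* `M(C2)² ≤ 225 (N+1)⁻² W Σ_k w_k ‖a_k‖⁴ dep2_k`, `M(C3)² ≤ 90 (N+1)⁻² W Σ_k w_k ‖a_k‖⁶ dep3_k`
  (`mterm_two_sq_le`, `mterm_three_sq_le`: the probe bounds and Cauchy–Schwarz with the weights);
* `R(C)² ≤ 6 (N+1)⁻² W Σ_k Σ_i |w_i − w_k| ω_{ki} ‖a_k‖^{2r}` for `‖C‖_F ≤ 1`
  (`rterm_two_sq_le`, `rterm_three_sq_le`: the carrier bounds, Cauchy–Schwarz with the weights
  `|w_i − w_k| ω_{ki}`, whose total is `≤ 6W` by the row and column sums of `ω`);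
* summed over the twelve tests (`sum_sq_pastF_le`), and with the shift expanded — `‖v_k − u‖^p`
  against `‖v_k‖^p` (velocity cut-off `fastPow`) and `‖u‖^p` (Jensen for the block velocity,
  `…TLPastDampingKernel`) — the PATHWISE PAST INEQUALITY `pastSq_le_integrableForm`: at every `(s, x)`
  of a configuration whose block weights have total `≤ Wm`,
  `PastSq ≤ 10⁸ (N+1)⁻² Wm · [V⁴ Σ_k w_k dep2_k + V⁶ Σ_k w_k dep3_k + (V⁴ + V⁶) Σ_{k,i} |w_i − w_k| ω_{ki}`
  `+ Σ_k (fast₄ + fast₆)(v_k)(Σ_i w_i ω_{ki} + 3 w_k) + Σ_j w_j (fast₄ + fast₆)(v_j(s))]`,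
  every bracket term being an `x`-INDEPENDENT coefficient times a weight `w_k(x)`, an increment
  `|w_i(x) − w_k(x)|`, or `Σ_i w_i(x) ω_{ki}` — ready for the `x`-integration.
-/

namespace Summit.AtomisticToContinuum.HydrodynamicLimit.Theorems.ContactSourceDuhamel.TimeLocal
namespace PastDamping

open scoped BigOperators Topology Classical MeasureTheory ENNReal InnerProductSpace
open Filter Set MeasureTheory

noncomputable section

variable {σ : ℝ} {N : ℕ} {y : Cfg N}

/-! ## The remainder read carrier by carrier -/

/-- **Rank 2, carrier by carrier**: `|⟨C, 𝒯(δ_k a ⊗ a)_i⟩| ≤ ‖a‖² ω_{ki}` for `‖C‖_F ≤ 1`. -/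
theorem abs_pairT_oneSite_two_le {C : Tens 2} (hC : Real.sqrt (normSqT C) ≤ 1) (m : ℕ)
    (k i : Fin (N + 1)) (a : V3) :
    |pairT C (tTransport 2 σ N y 0 m (Pi.single k (tpow 2 a)) i)| ≤ ‖a‖ ^ 2 * omegaAt σ N y m k i := by
  obtain ⟨h0, h2, -⟩ := massAt_bounds σ N y m k a i
  have hsq : Real.sqrt (normSqT (tTransport 2 σ N y 0 m (Pi.single k (tpow 2 a)) i)) ≤ massAt σ N y m k a i := by
    rw [← Real.sqrt_sq h0]
    exact Real.sqrt_le_sqrt h2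
  calc |pairT C (tTransport 2 σ N y 0 m (Pi.single k (tpow 2 a)) i)|
      ≤ Real.sqrt (normSqT C) * Real.sqrt (normSqT (tTransport 2 σ N y 0 m (Pi.single k (tpow 2 a)) i)) :=
        ColumnDepolarisation.abs_pairT_le _ _
    _ ≤ 1 * massAt σ N y m k a i := mul_le_mul hC hsq (Real.sqrt_nonneg _) zero_le_one
    _ ≤ ‖a‖ ^ 2 * omegaAt σ N y m k i := by rw [one_mul]; exact massAt_le_omegaAt m k a i

/-- **Rank 3, carrier by carrier**: `|⟨C, 𝒯(δ_k a^{⊗3})_i⟩| ≤ ‖a‖³ ω_{ki}` for `‖C‖_F ≤ 1`. -/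
theorem abs_pairT_oneSite_three_le {C : Tens 3} (hC : Real.sqrt (normSqT C) ≤ 1) (m : ℕ)
    (k i : Fin (N + 1)) (a : V3) :
    |pairT C (tTransport 3 σ N y 0 m (Pi.single k (tpow 3 a)) i)| ≤ ‖a‖ ^ 3 * omegaAt σ N y m k i := by
  obtain ⟨h0, -, h3⟩ := massAt_bounds σ N y m k a i
  have hsq : Real.sqrt (normSqT (tTransport 3 σ N y 0 m (Pi.single k (tpow 3 a)) i)) ≤
      ‖a‖ * massAt σ N y m k a i := by
    rw [← Real.sqrt_sq (mul_nonneg (norm_nonneg a) h0)]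
    refine Real.sqrt_le_sqrt ?_
    rw [mul_pow]
    exact h3
  calc |pairT C (tTransport 3 σ N y 0 m (Pi.single k (tpow 3 a)) i)|
      ≤ Real.sqrt (normSqT C) * Real.sqrt (normSqT (tTransport 3 σ N y 0 m (Pi.single k (tpow 3 a)) i)) :=
        ColumnDepolarisation.abs_pairT_le _ _
    _ ≤ 1 * (‖a‖ * massAt σ N y m k a i) :=
        mul_le_mul hC hsq (Real.sqrt_nonneg _) zero_le_one
    _ ≤ ‖a‖ * (‖a‖ ^ 2 * omegaAt σ N y m k i) := by
        rw [one_mul]; exact mul_le_mul_of_nonneg_left (massAt_le_omegaAt m k a i) (norm_nonneg a)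
    _ = ‖a‖ ^ 3 * omegaAt σ N y m k i := by ring

/-! ## Weighted Cauchy–Schwarz -/

/-- Weighted Cauchy–Schwarz: `(Σ θ_i x_i)² ≤ (Σ θ_i)(Σ θ_i x_i²)` for `θ ≥ 0`. -/
theorem sq_sum_mul_le {ι : Type*} (s : Finset ι) {θ : ι → ℝ} (hθ : ∀ i ∈ s, 0 ≤ θ i) (x : ι → ℝ) :
    (∑ i ∈ s, θ i * x i) ^ 2 ≤ (∑ i ∈ s, θ i) * ∑ i ∈ s, θ i * x i ^ 2 := by
  have h := Finset.sum_mul_sq_le_sq_mul_sq s (fun i => Real.sqrt (θ i)) (fun i => Real.sqrt (θ i) * x i)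
  have e1 : ∀ i ∈ s, Real.sqrt (θ i) * (Real.sqrt (θ i) * x i) = θ i * x i := fun i hi => by
    rw [← mul_assoc, Real.mul_self_sqrt (hθ i hi)]
  have e2 : ∀ i ∈ s, Real.sqrt (θ i) ^ 2 = θ i := fun i hi => Real.sq_sqrt (hθ i hi)
  have e3 : ∀ i ∈ s, (Real.sqrt (θ i) * x i) ^ 2 = θ i * x i ^ 2 := fun i hi => by
    rw [mul_pow, Real.sq_sqrt (hθ i hi)]
  rwa [Finset.sum_congr rfl e1, Finset.sum_congr rfl e2, Finset.sum_congr rfl e3] at h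

/-- An average of a sum, squared: `((N+1)⁻¹ S)² = (N+1)⁻² S²` bounded through `|S| ≤ T`. -/
theorem sq_avg_le_of_abs_le {S T : ℝ} (h : |S| ≤ T) :
    ((((N + 1 : ℕ) : ℝ))⁻¹ * S) ^ 2 ≤ ((((N + 1 : ℕ) : ℝ))⁻¹) ^ 2 * T ^ 2 := by
  rw [mul_pow]
  exact mul_le_mul_of_nonneg_left (sq_le_sq' (by linarith [abs_le.1 h]) (le_abs_self S |>.trans h))
    (sq_nonneg _)

/-! ## The mean terms, squared -/

/-- **Rank 2**: `M(C2 j k')² ≤ 225 (N+1)⁻² W Σ_k w_k ‖a_k‖⁴ dep2_k`. -/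
theorem mterm_two_sq_le {w : Fin (N + 1) → ℝ} (hw : ∀ i, 0 ≤ w i) (m : ℕ) (u : V3) (j k' : Fin 3) :
    (mterm 2 σ N y m w u (C2 j k')) ^ 2 ≤ ((((N + 1 : ℕ) : ℝ))⁻¹) ^ 2 *
      ((∑ i, w i) * ∑ k, w k * (225 * ((‖(y k).2 - u‖ ^ 2) ^ 2 * dep2 σ N y m k))) := by
  set e : Fin (N + 1) → ℝ := fun k => ∑ pq : Fin 3 × Fin 3,
    Real.sqrt (normSqT (cloud 2 σ N y m k (dirV pq.1 pq.2) - iso2 (dirV pq.1 pq.2))) with he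
  have he0 : ∀ k, 0 ≤ e k := fun k => Finset.sum_nonneg fun _ _ => Real.sqrt_nonneg _
  have he2 : ∀ k, e k ^ 2 ≤ 9 * dep2 σ N y m k := fun k => sq_sum_sqrt_le_dep2 m k
  -- `|M| ≤ (N+1)⁻¹ Σ_k w_k (5 ‖a_k‖² e_k)`
  have habs : |∑ k, w k * pairT (C2 j k') (cloud 2 σ N y m k ((y k).2 - u))| ≤
      ∑ k, w k * (5 * ‖(y k).2 - u‖ ^ 2 * e k) := by
    refine (Finset.abs_sum_le_sum_abs _ _).trans (Finset.sum_le_sum fun k _ => ?_)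
    rw [abs_mul, abs_of_nonneg (hw k)]
    exact mul_le_mul_of_nonneg_left (abs_pairT_C2_cloud_le j k' m k _) (hw k)
  refine (sq_avg_le_of_abs_le habs).trans (mul_le_mul_of_nonneg_left ?_ (sq_nonneg _))
  refine (sq_sum_mul_le Finset.univ (fun i _ => hw i) _).trans ?_
  refine mul_le_mul_of_nonneg_left (Finset.sum_le_sum fun k _ => ?_) (Finset.sum_nonneg fun i _ => hw i)
  refine mul_le_mul_of_nonneg_left ?_ (hw k)
  have h4 : 0 ≤ (‖(y k).2 - u‖ ^ 2) ^ 2 := sq_nonneg _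
  calc (5 * ‖(y k).2 - u‖ ^ 2 * e k) ^ 2 = 25 * (‖(y k).2 - u‖ ^ 2) ^ 2 * e k ^ 2 := by ring
    _ ≤ 25 * (‖(y k).2 - u‖ ^ 2) ^ 2 * (9 * dep2 σ N y m k) :=
        mul_le_mul_of_nonneg_left (he2 k) (by positivity)
    _ = 225 * ((‖(y k).2 - u‖ ^ 2) ^ 2 * dep2 σ N y m k) := by ring

/-- **Rank 3**: `M(C3 a₀)² ≤ 90 (N+1)⁻² W Σ_k w_k ‖a_k‖⁶ dep3_k`. -/
theorem mterm_three_sq_le {w : Fin (N + 1) → ℝ} (hw : ∀ i, 0 ≤ w i) (m : ℕ) (u : V3) (a₀ : Fin 3) :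
    (mterm 3 σ N y m w u (C3 a₀)) ^ 2 ≤ ((((N + 1 : ℕ) : ℝ))⁻¹) ^ 2 *
      ((∑ i, w i) * ∑ k, w k * (90 * ((‖(y k).2 - u‖ ^ 2) ^ 3 * dep3 σ N y m k))) := by
  set f : Fin (N + 1) → ℝ := fun k => ∑ p : Fin 10,
    Real.sqrt (normSqT (cloud 3 σ N y m k (udir p))) with hf
  have hf2 : ∀ k, f k ^ 2 ≤ 10 * dep3 σ N y m k := fun k => sq_sum_sqrt_le_dep3 m k
  have habs : |∑ k, w k * pairT (C3 a₀) (cloud 3 σ N y m k ((y k).2 - u))| ≤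
      ∑ k, w k * (3 * ‖(y k).2 - u‖ ^ 3 * f k) := by
    refine (Finset.abs_sum_le_sum_abs _ _).trans (Finset.sum_le_sum fun k _ => ?_)
    rw [abs_mul, abs_of_nonneg (hw k)]
    exact mul_le_mul_of_nonneg_left (abs_pairT_C3_cloud_le a₀ m k _) (hw k)
  refine (sq_avg_le_of_abs_le habs).trans (mul_le_mul_of_nonneg_left ?_ (sq_nonneg _))
  refine (sq_sum_mul_le Finset.univ (fun i _ => hw i) _).trans ?_
  refine mul_le_mul_of_nonneg_left (Finset.sum_le_sum fun k _ => ?_) (Finset.sum_nonneg fun i _ => hw i)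
  refine mul_le_mul_of_nonneg_left ?_ (hw k)
  have h6 : 0 ≤ (‖(y k).2 - u‖ ^ 2) ^ 3 := pow_nonneg (sq_nonneg _) 3
  calc (3 * ‖(y k).2 - u‖ ^ 3 * f k) ^ 2 = 9 * (‖(y k).2 - u‖ ^ 2) ^ 3 * f k ^ 2 := by ring
    _ ≤ 9 * (‖(y k).2 - u‖ ^ 2) ^ 3 * (10 * dep3 σ N y m k) :=
        mul_le_mul_of_nonneg_left (hf2 k) (by positivity)
    _ = 90 * ((‖(y k).2 - u‖ ^ 2) ^ 3 * dep3 σ N y m k) := by ring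

/-! ## The remainders, squared -/

/-- The total of the remainder weights: `Σ_k Σ_i |w_i − w_k| ω_{ki} ≤ 6 W` (row and column sums `3`). -/
theorem sum_abs_sub_mul_omegaAt_le {w : Fin (N + 1) → ℝ} (hw : ∀ i, 0 ≤ w i) (m : ℕ) :
    ∑ k, ∑ i, |w i - w k| * omegaAt σ N y m k i ≤ 6 * ∑ i, w i := by
  calc ∑ k, ∑ i, |w i - w k| * omegaAt σ N y m k i
      ≤ ∑ k, ∑ i, (w i + w k) * omegaAt σ N y m k i :=
        Finset.sum_le_sum fun k _ => Finset.sum_le_sum fun i _ =>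
          mul_le_mul_of_nonneg_right ((abs_sub _ _).trans (by rw [abs_of_nonneg (hw i),
            abs_of_nonneg (hw k)])) (omegaAt_nonneg m k i)
    _ = ∑ i, w i * (∑ k, omegaAt σ N y m k i) + ∑ k, w k * ∑ i, omegaAt σ N y m k i := by
        simp only [add_mul, Finset.sum_add_distrib, Finset.mul_sum]
        rw [Finset.sum_comm]
    _ = 6 * ∑ i, w i := by
        simp only [sum_sites_omegaAt, sum_carriers_omegaAt, ← Finset.sum_mul]
        ring

/-- Weighted Cauchy–Schwarz over sites and carriers. -/
theorem sq_sum_sum_mul_le {θ : Fin (N + 1) → Fin (N + 1) → ℝ} (hθ : ∀ k i, 0 ≤ θ k i)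
    (x : Fin (N + 1) → ℝ) :
    (∑ k, ∑ i, θ k i * x k) ^ 2 ≤ (∑ k, ∑ i, θ k i) * ∑ k, ∑ i, θ k i * x k ^ 2 := by
  have h := sq_sum_mul_le (Finset.univ ×ˢ Finset.univ) (θ := fun ki : Fin (N + 1) × Fin (N + 1) =>
    θ ki.1 ki.2) (fun ki _ => hθ ki.1 ki.2) (fun ki => x ki.1)
  simpa only [Finset.sum_product] using h

/-- **Rank 2**: `R(C)² ≤ 6 (N+1)⁻² W Σ_k Σ_i |w_i − w_k| ω_{ki} ‖a_k‖⁴` for `‖C‖_F ≤ 1`. -/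
theorem rterm_two_sq_le {w : Fin (N + 1) → ℝ} (hw : ∀ i, 0 ≤ w i) (m : ℕ) (u : V3) {C : Tens 2}
    (hC : Real.sqrt (normSqT C) ≤ 1) :
    (rterm 2 σ N y m w u C) ^ 2 ≤ ((((N + 1 : ℕ) : ℝ))⁻¹) ^ 2 *
      ((6 * ∑ i, w i) * ∑ k, ∑ i, |w i - w k| * omegaAt σ N y m k i * (‖(y k).2 - u‖ ^ 2) ^ 2) := by
  have habs : |∑ k, ∑ i, (w i - w k) *
      pairT C (tTransport 2 σ N y 0 m (Pi.single k (tpow 2 ((y k).2 - u))) i)| ≤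
      ∑ k, ∑ i, |w i - w k| * omegaAt σ N y m k i * ‖(y k).2 - u‖ ^ 2 := by
    refine (Finset.abs_sum_le_sum_abs _ _).trans (Finset.sum_le_sum fun k _ =>
      (Finset.abs_sum_le_sum_abs _ _).trans (Finset.sum_le_sum fun i _ => ?_))
    rw [abs_mul, mul_assoc]
    refine mul_le_mul_of_nonneg_left ?_ (abs_nonneg _)
    rw [mul_comm]
    exact abs_pairT_oneSite_two_le hC m k i _
  refine (sq_avg_le_of_abs_le habs).trans (mul_le_mul_of_nonneg_left ?_ (sq_nonneg _))
  refine (sq_sum_sum_mul_le (fun k i => mul_nonneg (abs_nonneg _) (omegaAt_nonneg m k i)) _).trans ?_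
  exact mul_le_mul_of_nonneg_right (sum_abs_sub_mul_omegaAt_le hw m)
    (Finset.sum_nonneg fun k _ => Finset.sum_nonneg fun i _ =>
      mul_nonneg (mul_nonneg (abs_nonneg _) (omegaAt_nonneg m k i)) (sq_nonneg _))

/-- **Rank 3**: `R(C)² ≤ 6 (N+1)⁻² W Σ_k Σ_i |w_i − w_k| ω_{ki} ‖a_k‖⁶` for `‖C‖_F ≤ 1`. -/
theorem rterm_three_sq_le {w : Fin (N + 1) → ℝ} (hw : ∀ i, 0 ≤ w i) (m : ℕ) (u : V3) {C : Tens 3}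
    (hC : Real.sqrt (normSqT C) ≤ 1) :
    (rterm 3 σ N y m w u C) ^ 2 ≤ ((((N + 1 : ℕ) : ℝ))⁻¹) ^ 2 *
      ((6 * ∑ i, w i) * ∑ k, ∑ i, |w i - w k| * omegaAt σ N y m k i * (‖(y k).2 - u‖ ^ 2) ^ 3) := by
  have habs : |∑ k, ∑ i, (w i - w k) *
      pairT C (tTransport 3 σ N y 0 m (Pi.single k (tpow 3 ((y k).2 - u))) i)| ≤
      ∑ k, ∑ i, |w i - w k| * omegaAt σ N y m k i * ‖(y k).2 - u‖ ^ 3 := by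
    refine (Finset.abs_sum_le_sum_abs _ _).trans (Finset.sum_le_sum fun k _ =>
      (Finset.abs_sum_le_sum_abs _ _).trans (Finset.sum_le_sum fun i _ => ?_))
    rw [abs_mul, mul_assoc]
    refine mul_le_mul_of_nonneg_left ?_ (abs_nonneg _)
    rw [mul_comm]
    exact abs_pairT_oneSite_three_le hC m k i _
  refine (sq_avg_le_of_abs_le habs).trans (mul_le_mul_of_nonneg_left ?_ (sq_nonneg _))
  refine (sq_sum_sum_mul_le (fun k i => mul_nonneg (abs_nonneg _) (omegaAt_nonneg m k i)) _).trans ?_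
  have h6 : ∀ k : Fin (N + 1), (‖(y k).2 - u‖ ^ 3) ^ 2 = (‖(y k).2 - u‖ ^ 2) ^ 3 := fun k => by ring
  simp only [h6]
  exact mul_le_mul_of_nonneg_right (sum_abs_sub_mul_omegaAt_le hw m)
    (Finset.sum_nonneg fun k _ => Finset.sum_nonneg fun i _ =>
      mul_nonneg (mul_nonneg (abs_nonneg _) (omegaAt_nonneg m k i)) (pow_nonneg (sq_nonneg _) 3))

/-! ## Summed over the twelve tests -/

/-- **`Σ_tests PAST²` at the algebraic level**: for non-negative weights with total `W`,
`Σ_{jk'} PAST(C2)² + Σ_a PAST(C3)² ≤ 2 (N+1)⁻² W [9(225 M₂ + 6 R₂) + 3(90 M₃ + 6 R₃)]`. -/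
theorem sum_sq_pastF_le {w : Fin (N + 1) → ℝ} (hw : ∀ i, 0 ≤ w i) (m : ℕ) (u : V3) :
    (∑ j : Fin 3, ∑ k' : Fin 3, (pastF 2 σ N y m w u (C2 j k')) ^ 2) +
        ∑ a₀ : Fin 3, (pastF 3 σ N y m w u (C3 a₀)) ^ 2 ≤
      2 * ((((N + 1 : ℕ) : ℝ))⁻¹) ^ 2 * (∑ i, w i) *
        (9 * ((∑ k, w k * (225 * ((‖(y k).2 - u‖ ^ 2) ^ 2 * dep2 σ N y m k))) +
            6 * ∑ k, ∑ i, |w i - w k| * omegaAt σ N y m k i * (‖(y k).2 - u‖ ^ 2) ^ 2) +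
          3 * ((∑ k, w k * (90 * ((‖(y k).2 - u‖ ^ 2) ^ 3 * dep3 σ N y m k))) +
            6 * ∑ k, ∑ i, |w i - w k| * omegaAt σ N y m k i * (‖(y k).2 - u‖ ^ 2) ^ 3)) := by
  set c := ((((N + 1 : ℕ) : ℝ))⁻¹) ^ 2 with hc
  set W := ∑ i, w i with hW
  set M2 := ∑ k, w k * (225 * ((‖(y k).2 - u‖ ^ 2) ^ 2 * dep2 σ N y m k)) with hM2
  set R2 := ∑ k, ∑ i, |w i - w k| * omegaAt σ N y m k i * (‖(y k).2 - u‖ ^ 2) ^ 2 with hR2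
  set M3 := ∑ k, w k * (90 * ((‖(y k).2 - u‖ ^ 2) ^ 3 * dep3 σ N y m k)) with hM3
  set R3 := ∑ k, ∑ i, |w i - w k| * omegaAt σ N y m k i * (‖(y k).2 - u‖ ^ 2) ^ 3 with hR3
  have h2 : ∀ j k' : Fin 3, (pastF 2 σ N y m w u (C2 j k')) ^ 2 ≤ 2 * (c * (W * M2) + c * (6 * W * R2)) := by
    intro j k'
    rw [pastF_eq_mterm_add_rterm]
    have hsq : ∀ a b : ℝ, (a + b) ^ 2 ≤ 2 * (a ^ 2 + b ^ 2) := fun a b => by nlinarith [sq_nonneg (a - b)]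
    refine (hsq _ _).trans (mul_le_mul_of_nonneg_left (add_le_add
      (mterm_two_sq_le hw m u j k') (rterm_two_sq_le hw m u (sqrt_normSqT_C2_le j k'))) (by norm_num))
  have h3 : ∀ a₀ : Fin 3, (pastF 3 σ N y m w u (C3 a₀)) ^ 2 ≤ 2 * (c * (W * M3) + c * (6 * W * R3)) := by
    intro a₀
    rw [pastF_eq_mterm_add_rterm]
    have hsq : ∀ a b : ℝ, (a + b) ^ 2 ≤ 2 * (a ^ 2 + b ^ 2) := fun a b => by nlinarith [sq_nonneg (a - b)]
    refine (hsq _ _).trans (mul_le_mul_of_nonneg_left (add_le_add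
      (mterm_three_sq_le hw m u a₀) (rterm_three_sq_le hw m u (sqrt_normSqT_C3_le a₀))) (by norm_num))
  calc (∑ j : Fin 3, ∑ k' : Fin 3, (pastF 2 σ N y m w u (C2 j k')) ^ 2) +
        ∑ a₀ : Fin 3, (pastF 3 σ N y m w u (C3 a₀)) ^ 2
      ≤ (∑ _j : Fin 3, ∑ _k' : Fin 3, 2 * (c * (W * M2) + c * (6 * W * R2))) +
          ∑ _a₀ : Fin 3, 2 * (c * (W * M3) + c * (6 * W * R3)) :=
        add_le_add (Finset.sum_le_sum fun j _ => Finset.sum_le_sum fun k' _ => h2 j k')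
          (Finset.sum_le_sum fun a₀ _ => h3 a₀)
    _ = 2 * c * W * (9 * (M2 + 6 * R2) + 3 * (M3 + 6 * R3)) := by
        simp only [Finset.sum_const, Finset.card_univ, Fintype.card_fin, nsmul_eq_mul]
        push_cast
        ring

/-! ## Expanding the shift: velocity cut-off and Jensen -/

/-- `‖v − u‖^{2q}` against `‖v‖^{2q}` and `‖u‖^{2q}`: `(‖v − u‖²)^q ≤ 2^{2q−1} (‖v‖^{2q} + ‖u‖^{2q})`. -/
theorem norm_sub_sq_pow_le (v u : V3) (q : ℕ) :
    (‖v - u‖ ^ 2) ^ q ≤ 2 ^ (2 * q - 1) * (‖v‖ ^ (2 * q) + ‖u‖ ^ (2 * q)) := by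
  rw [← pow_mul]
  exact (pow_le_pow_left₀ (norm_nonneg _) (norm_sub_le v u) _).trans
    (add_pow_le (norm_nonneg v) (norm_nonneg u) _)

/-- A quantity dominated by `c W` (`c, W ≥ 0`) has quotient by `W` at most `c` (`0⁻¹ = 0`). -/
theorem mul_inv_le_of_le_mul {θ W c : ℝ} (hW : 0 ≤ W) (hc : 0 ≤ c) (h : θ ≤ c * W) :
    θ * W⁻¹ ≤ c := by
  rcases hW.eq_or_lt with hW0 | hWpos
  · rw [← hW0, inv_zero, mul_zero]; exact hc
  · rw [mul_inv_le_iff₀ hWpos]; exact h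

/-- **Jensen for the block velocity, divided form**: `‖ū‖^p ≤ 2^{p−1} (V^p + W⁻¹ Σ_j w_j fastPow p V v_j)`
(`p ≥ 1`, `V ≥ 0`; at `W = 0` both sides read with `0⁻¹ = 0` and `ū = 0`). -/
theorem norm_ubar_pow_le (Φ : Flow σ N) {φ : ℕ → T3 → ℝ} (hφ0 : ∀ y, 0 ≤ φ N y) (s : ℝ) (z : Cfg N)
    (x : T3) {p : ℕ} (hp : 1 ≤ p) {V : ℝ} (hV : 0 ≤ V) :
    ‖ubar σ N Φ φ s z x‖ ^ p ≤ 2 ^ (p - 1) * (V ^ p +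
      (∑ i, wgt σ N Φ φ s z x i)⁻¹ * ∑ i, wgt σ N Φ φ s z x i * fastPow p V (Φ.flow s z i).2) := by
  have h := sum_wgt_mul_norm_ubar_pow_le Φ hφ0 s z x hp hV
  set W := ∑ i, wgt σ N Φ φ s z x i with hW
  have hW0 : 0 ≤ W := Finset.sum_nonneg fun i _ => hφ0 _
  rcases hW0.eq_or_lt with hW00 | hWpos
  · -- no weight: `ū = 0`
    have hu : ubar σ N Φ φ s z x = 0 := by
      rw [Reduction.ubar_eq]
      have : ∑ i, φ N ((Φ.flow s z i).1 - x) = 0 := hW00.symm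
      rw [this, mul_zero, inv_zero, zero_smul]
    rw [hu, norm_zero, zero_pow (by omega), ← hW00, inv_zero, zero_mul, add_zero]
    positivity
  · have h' : W * ‖ubar σ N Φ φ s z x‖ ^ p ≤
        W * (2 ^ (p - 1) * (V ^ p + W⁻¹ * ∑ i, wgt σ N Φ φ s z x i * fastPow p V (Φ.flow s z i).2)) := by
      refine h.trans (le_of_eq ?_)
      field_simp
    exact le_of_mul_le_mul_left h' hWpos

/-- **Expanding the shift in a weighted sum**: for non-negative `x`-weights `θ_k` with
`Σ_k θ_k ≤ c W` and `θ_k ≤ θ'_k`-type fast bound supplied as `hfast`, and `q ≥ 1`, `V ≥ 0`: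
`Σ_k θ_k (‖v_k − ū‖²)^q ≤ 2^{2q−1} [ (1 + 2^{2q−1}) V^{2q} Σ_k θ_k + Σ_k θ_k fastPow_{2q}(v_k)`
`+ 2^{2q−1} c Σ_j w_j fastPow_{2q}(v_j(s)) ]`. -/
theorem sum_mul_shift_pow_le (Φ : Flow σ N) {φ : ℕ → T3 → ℝ} (hφ0 : ∀ y, 0 ≤ φ N y) (s : ℝ)
    (z : Cfg N) (x : T3) (v : Fin (N + 1) → V3) {θ : Fin (N + 1) → ℝ} (hθ : ∀ k, 0 ≤ θ k) {c : ℝ}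
    (hc : 0 ≤ c) (hθW : ∑ k, θ k ≤ c * ∑ i, wgt σ N Φ φ s z x i) {q : ℕ} (hq : 1 ≤ q) {V : ℝ}
    (hV : 0 ≤ V) :
    ∑ k, θ k * (‖v k - ubar σ N Φ φ s z x‖ ^ 2) ^ q ≤
      2 ^ (2 * q - 1) * ((1 + 2 ^ (2 * q - 1)) * V ^ (2 * q) * ∑ k, θ k +
        ∑ k, θ k * fastPow (2 * q) V (v k) +
        2 ^ (2 * q - 1) * c * ∑ i, wgt σ N Φ φ s z x i * fastPow (2 * q) V (Φ.flow s z i).2) := by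
  set u := ubar σ N Φ φ s z x with hu
  set W := ∑ i, wgt σ N Φ φ s z x i with hW
  set F := ∑ i, wgt σ N Φ φ s z x i * fastPow (2 * q) V (Φ.flow s z i).2 with hF
  have hW0 : 0 ≤ W := Finset.sum_nonneg fun i _ => hφ0 _
  have hF0 : 0 ≤ F := Finset.sum_nonneg fun i _ => mul_nonneg (hφ0 _) (fastPow_nonneg _ _ _)
  have hΘ0 : 0 ≤ ∑ k, θ k := Finset.sum_nonneg fun k _ => hθ k
  have h2q : 1 ≤ 2 * q := by omega
  -- Jensen, divided
  have hJ : ‖u‖ ^ (2 * q) ≤ 2 ^ (2 * q - 1) * (V ^ (2 * q) + W⁻¹ * F) :=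
    norm_ubar_pow_le Φ hφ0 s z x h2q hV
  -- per site
  have hk : ∀ k, θ k * (‖v k - u‖ ^ 2) ^ q ≤
      2 ^ (2 * q - 1) * (θ k * (V ^ (2 * q) + fastPow (2 * q) V (v k)) +
        θ k * (2 ^ (2 * q - 1) * (V ^ (2 * q) + W⁻¹ * F))) := by
    intro k
    calc θ k * (‖v k - u‖ ^ 2) ^ q ≤ θ k * (2 ^ (2 * q - 1) * (‖v k‖ ^ (2 * q) + ‖u‖ ^ (2 * q))) :=
          mul_le_mul_of_nonneg_left (norm_sub_sq_pow_le _ _ q) (hθ k)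
      _ ≤ θ k * (2 ^ (2 * q - 1) * ((V ^ (2 * q) + fastPow (2 * q) V (v k)) +
            2 ^ (2 * q - 1) * (V ^ (2 * q) + W⁻¹ * F))) := by
          refine mul_le_mul_of_nonneg_left (mul_le_mul_of_nonneg_left (add_le_add
            (norm_pow_le_add_fastPow hV _ _) hJ) (by positivity)) (hθ k)
      _ = _ := by ring
  refine (Finset.sum_le_sum fun k _ => hk k).trans ?_
  rw [← Finset.mul_sum, Finset.sum_add_distrib]
  refine mul_le_mul_of_nonneg_left ?_ (by positivity)
  simp only [mul_add, Finset.sum_add_distrib, ← Finset.sum_mul]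
  -- the `W⁻¹` term: `(Σ θ) W⁻¹ F ≤ c F`
  have hquot : (∑ k, θ k) * W⁻¹ ≤ c := mul_inv_le_of_le_mul hW0 hc hθW
  have hlast : (∑ k, θ k) * (2 ^ (2 * q - 1) * (W⁻¹ * F)) ≤ 2 ^ (2 * q - 1) * c * F := by
    calc (∑ k, θ k) * (2 ^ (2 * q - 1) * (W⁻¹ * F)) = 2 ^ (2 * q - 1) * ((∑ k, θ k) * W⁻¹) * F := by
          ring
      _ ≤ 2 ^ (2 * q - 1) * c * F := by gcongr
  nlinarith [hlast]

/-- `sum_mul_shift_pow_le` at `q = 2` (fourth powers). -/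
theorem sum_mul_shift_pow_two_le (Φ : Flow σ N) {φ : ℕ → T3 → ℝ} (hφ0 : ∀ y, 0 ≤ φ N y) (s : ℝ)
    (z : Cfg N) (x : T3) (v : Fin (N + 1) → V3) {θ : Fin (N + 1) → ℝ} (hθ : ∀ k, 0 ≤ θ k) {c : ℝ}
    (hc : 0 ≤ c) (hθW : ∑ k, θ k ≤ c * ∑ i, wgt σ N Φ φ s z x i) {V : ℝ} (hV : 0 ≤ V) :
    ∑ k, θ k * (‖v k - ubar σ N Φ φ s z x‖ ^ 2) ^ 2 ≤
      8 * (9 * V ^ 4 * ∑ k, θ k + ∑ k, θ k * fastPow 4 V (v k) +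
        8 * c * ∑ i, wgt σ N Φ φ s z x i * fastPow 4 V (Φ.flow s z i).2) := by
  have h := sum_mul_shift_pow_le Φ hφ0 s z x v hθ hc hθW (q := 2) (by norm_num) hV
  norm_num at h
  linarith [h]

/-- `sum_mul_shift_pow_le` at `q = 3` (sixth powers). -/
theorem sum_mul_shift_pow_three_le (Φ : Flow σ N) {φ : ℕ → T3 → ℝ} (hφ0 : ∀ y, 0 ≤ φ N y) (s : ℝ)
    (z : Cfg N) (x : T3) (v : Fin (N + 1) → V3) {θ : Fin (N + 1) → ℝ} (hθ : ∀ k, 0 ≤ θ k) {c : ℝ}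
    (hc : 0 ≤ c) (hθW : ∑ k, θ k ≤ c * ∑ i, wgt σ N Φ φ s z x i) {V : ℝ} (hV : 0 ≤ V) :
    ∑ k, θ k * (‖v k - ubar σ N Φ φ s z x‖ ^ 2) ^ 3 ≤
      32 * (33 * V ^ 6 * ∑ k, θ k + ∑ k, θ k * fastPow 6 V (v k) +
        32 * c * ∑ i, wgt σ N Φ φ s z x i * fastPow 6 V (Φ.flow s z i).2) := by
  have h := sum_mul_shift_pow_le Φ hφ0 s z x v hθ hc hθW (q := 3) (by norm_num) hV
  norm_num at h
  linarith [h]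

/-- Registered anchor of this helper file (the total of the remainder weights,
`sum_abs_sub_mul_omegaAt_le` with `omegaAt`, `massAt`, `trT` unfolded). -/
theorem pastDamping_pointwise_anchor : ∀ (σ : ℝ) (N : ℕ) (y : Cfg N) (m : ℕ) (w : Fin (N + 1) → ℝ), (∀ i, 0 ≤ w i) → ∑ k : Fin (N + 1), ∑ i : Fin (N + 1), |w i - w k| * (∑ c : Fin 3, ∑ d : Fin 3, tTransport 2 σ N y 0 m (Pi.single k (tpow 2 (baseV c))) i ![d, d]) ≤ 6 * ∑ i : Fin (N + 1), w i :=
  fun _ _ _ m _ hw => sum_abs_sub_mul_omegaAt_le hw m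

end

end PastDamping
end Summit.AtomisticToContinuum.HydrodynamicLimit.Theorems.ContactSourceDuhamel.TimeLocal
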